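import Summits.AtomisticToContinuum.HydrodynamicLimit.Theses.InformationPercolationEngine
import Summits.AtomisticToContinuum.HydrodynamicLimit.Theses.TwoClocks
import Summits.AtomisticToContinuum.HydrodynamicLimit.Theses.LimitCollisionMeasure
import Summits.AtomisticToContinuum.HydrodynamicLimit.Theorems.InformationPercolationEngineChaosClosesEulerInitialLayer
import Summits.AtomisticToContinuum.HydrodynamicLimit.Theorems.InformationPercolationEngineChaosClosesEulerWeakEquation
import Summits.AtomisticToContinuum.HydrodynamicLimit.Theorems.InformationPercolationEngineChaosClosesEulerEnskogIdentity
import Summits.AtomisticToContinuum.HydrodynamicLimit.Theorems.InformationPercolationEngineChaosClosesEulerCollisionMomentUI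
import Summits.AtomisticToContinuum.HydrodynamicLimit.Theorems.InformationPercolationEngineChaosClosesEulerReadout
import Summits.AtomisticToContinuum.HydrodynamicLimit.Theorems.InformationPercolationEngineChaosClosesEulerMassBalanceC1
import Summits.AtomisticToContinuum.HydrodynamicLimit.Theorems.InformationPercolationEngineChaosClosesEulerBF18Shell
import Summits.AtomisticToContinuum.HydrodynamicLimit.Theorems.InformationPercolationEngineChaosClosesEulerKineticReduction
import Summits.AtomisticToContinuum.HydrodynamicLimit.Theorems.InformationPercolationEngineChaosClosesEulerMaxwellianMoments
import Summits.AtomisticToContinuum.HydrodynamicLimit.Theorems.InformationPercolationEngineChaosClosesEulerStressIsotropy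
import Summits.AtomisticToContinuum.HydrodynamicLimit.Theorems.InformationPercolationEngineChaosClosesEulerPressureValue
import HarnessLib

/-!
# The local-equilibrium DOCK of the crux `InformationPercolationEngine.ChaosClosesEuler` (stmt-AtomisticToContinuum-15141)

Line `Sketch`, skeleton v12 (`Cruxes/ChaosClosesEuler/Lines/Sketch.lean`): the composition
`chaosClosesEuler_of_localEquilibriumLevel` of the registered skeleton, now SORRY-FREE after wave 9 landed the two
in-band flux closures (`ChaosClosesEulerStressIsotropy.stub_stressIsotropyOfLocalEquilibrium` p148636,
`ChaosClosesEulerPressureValue.stub_pressureValueOfEnskog` p156386) and the Gaussian moments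
(`ChaosClosesEulerMaxwellianMoments.stub_maxwellianMoments` p145917), on top of the deterministic
Březina–Feireisl core (`…BF18Shell` p136414), the kinetic reduction (`…KineticReduction` p138091), the weak readout
(`…Readout` p119530), the exact weak equation, the `C¹` mass balance, the initial layer, the empirical Enskog
identity and the uniform integrability of the quadratic collision mark (all landed, cycles 1–4).

THE THEOREM.  `ChaosClosesEuler` (= `ContactChaos → CollisionRate → LocalSecondLaw → HydroLimitInBand`) follows from
SIX inputs: the two NEW pointwise kinetic statements of skeleton v11 §1b — POINTWISE LOCAL EQUILIBRIUM at scale `r`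
in band (hypothesis `hPLE`, body verbatim `PointwiseLocalEquilibrium`; the crux-strategist's child
`KineticLocalEquilibrium`, `Cruxes/ChaosClosesEuler/SPLIT-REQUEST.md`) and POINTWISE ENSKOG COLLISION STATISTICS
(hypothesis `hPEC`, body verbatim `PointwiseEnskogCollisions`; child of the same name) — and four EXISTING items of
the board taken by name: the clamped local second law `LimitCollisionMeasure.LocalSecondLaw` (stmt-13352), the
quartic collision tightness `LimitCollisionMeasure.CollisionTightness` (stmt-13354), the cubic one-body tails
`TwoClocks.EnergyCurrentTails` (stmt-9235) and this route's fine-scale cap `DensityCap` (stmt-13082).  Of the crux's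
own antecedents only `CollisionRate` (13481) is consumed (reduction + readout, fixed bump tests); `ContactChaos`
(13477, same-time, fixed `χ`) and `LocalSecondLaw` (13081, unclamped) are not (wrong formats: lead NOTES
`Cruxes/ChaosClosesEuler/NOTES.md` §B2/§B3/§F).  This is exactly the generated glue item `LocalEquilibriumDock` of
the strategist's split (curried; `DensityCap` explicit).

No `sorry`, no new definition: the two new inputs are carried as hypotheses with their bodies inlined, so that the
planner's children (stated `Iff.rfl`-identically) discharge them by `fun h => h`.

References: J. Březina, E. Feireisl, *Measure-valued solutions to the complete Euler system*, J. Math. Soc. Japan 70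
(2018) (weak–strong uniqueness, Thm 2.5 / §3.3); N. N. Bogolyubov, *Microscopic solutions of the Boltzmann–Enskog
equation in kinetic theory for elastic balls*, Theor. Math. Phys. 24 (1975).
-/

noncomputable section

namespace Summit.AtomisticToContinuum.HydrodynamicLimit.Theorems.ChaosClosesEulerDock

open scoped BigOperators Topology Classical MeasureTheory ENNReal InnerProductSpace
open Filter Set MeasureTheory
open Literature.MathematicalPhysics.KineticTheory
open Literature.Analysis.FluidPDE
open Summit.AtomisticToContinuum.HydrodynamicLimit.Theses
open Summit.AtomisticToContinuum.HydrodynamicLimit.Theses.InformationPercolationEngine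

/-- **The local-equilibrium dock** (line `Sketch`, skeleton v12 `chaosClosesEuler_of_localEquilibriumLevel`): pointwise
local equilibrium at scale `r` in band (`hPLE`), pointwise Enskog collision statistics (`hPEC`), the clamped local
second law (13352), quartic collision tightness (13354), cubic one-body tails (9235) and the fine-scale density cap
(13082) imply the crux `ChaosClosesEuler`.  Composition of landed theorems only: Gaussian moments ⇒ (with `hPLE`,
9235) weak stress isotropy in band and (with `hPLE`, `hPEC`, 9235, 13354 ⇒ UI of the quadratic collision mark) the
collisional pressure value in band; these feed the kinetic reduction over the deterministic BF18 shell (with the `C¹`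
mass balance, the exact weak equation, the initial layer, `CollisionRate`, 13352, 13082), whose window-averaged `L¹`
conclusion the weak readout (with the empirical Enskog identity, 9235, UI, `CollisionRate`, 13082) turns into the
crux's `χ`-tested convergence at every `t < T`. [cite: BrezinaFeireisl2018, Thm 2.5] -/
theorem chaosClosesEuler_of_pointwiseLocalEquilibrium
    (hPLE :
      ∃ η₀ : ℝ, 0 < η₀ ∧ ∀ (a₀ θ₀ : T3 → ℝ) (u₀ : T3 → V3), Continuous a₀ → Continuous θ₀ → Continuous u₀ →
        (∀ x, 0 < a₀ x) → (∀ x, 0 < θ₀ x) → ∃ σ₀ : ℝ, 0 < σ₀ ∧ ∀ σ : ℝ, 0 < σ → σ < σ₀ →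
        ∀ (T : ℝ) (ρ θ : ℝ → T3 → ℝ) (u : ℝ → T3 → V3), IsHardSphereEulerSolution σ T ρ u θ →
        ∀ Φ : (N : ℕ) → HardSphereFlow (Torus.geometry (Fin 3)) (hsDiameter σ N) (N + 1),
        TendstoHydroFieldsAt (fun N => localGibbsLaw σ a₀ u₀ θ₀ N (Φ N)) Φ ρ u θ 0 →
        ∀ t ∈ Set.Ico 0 T, ∀ ψ : V3 → ℝ, Continuous ψ → (∃ C : ℝ, ∀ v, |ψ v| ≤ C) →
        ∀ h : ℝ × V3 × ℝ → ℝ, Continuous h → (∃ C : ℝ, ∀ p, |h p| ≤ C) →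
        (∃ ρ₁ θ₁ Θ U : ℝ, 0 < ρ₁ ∧ 0 < θ₁ ∧ ∀ p : ℝ × V3 × ℝ,
          (p.1 ≤ ρ₁ ∨ η₀ ≤ σ ^ 3 * p.1 ∨ p.2.2 ≤ θ₁ ∨ Θ ≤ p.2.2 ∨ U ≤ ‖p.2.1‖) → h p = 0) →
        ∀ η δ : ℝ, 0 < η → 0 < δ → ∃ r₀ : ℝ, 0 < r₀ ∧ ∀ r : ℝ, 0 < r → r < r₀ → ∃ N₀ : ℕ, ∀ N : ℕ, N₀ ≤ N →
        let bx : T3 → T3 → ℝ := fun y x => 3 / (Real.pi * r ^ 3) * max (1 - Torus.euclidDist y x / r) 0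
        let ρm : Config (N + 1) (Fin 3) T3 → T3 → ℝ := fun w x₀ => ∫ q, bx q.1 x₀ ∂(empiricalMeasure w)
        let mm : Config (N + 1) (Fin 3) T3 → T3 → V3 := fun w x₀ => ∫ q, bx q.1 x₀ • q.2 ∂(empiricalMeasure w)
        let em : Config (N + 1) (Fin 3) T3 → T3 → ℝ := fun w x₀ =>
          ∫ q, bx q.1 x₀ * (‖q.2‖ ^ 2 / 2) ∂(empiricalMeasure w)
        let um : Config (N + 1) (Fin 3) T3 → T3 → V3 := fun w x₀ => (ρm w x₀)⁻¹ • mm w x₀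
        let θm : Config (N + 1) (Fin 3) T3 → T3 → ℝ := fun w x₀ =>
          2 / 3 * (em w x₀ / ρm w x₀ - ‖mm w x₀‖ ^ 2 / (2 * ρm w x₀ ^ 2))
        let Mψ : Config (N + 1) (Fin 3) T3 → T3 → ℝ := fun w x₀ => ∫ q, bx q.1 x₀ * ψ q.2 ∂(empiricalMeasure w)
        localGibbsLaw σ a₀ u₀ θ₀ N (Φ N)
          {z | η < ∫ s in Set.Icc 0 t, ∫ x,
            |h (ρm ((Φ N).flow s z) x, um ((Φ N).flow s z) x, θm ((Φ N).flow s z) x)| *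
              |Mψ ((Φ N).flow s z) x - ρm ((Φ N).flow s z) x *
                ∫ v, ψ v * localMaxwellian 1 (θm ((Φ N).flow s z) x) (um ((Φ N).flow s z) x) v|} ≤ ENNReal.ofReal δ)
    (hPEC :
      ∃ η₀ : ℝ, 0 < η₀ ∧ ∀ (a₀ θ₀ : T3 → ℝ) (u₀ : T3 → V3), Continuous a₀ → Continuous θ₀ → Continuous u₀ →
        (∀ x, 0 < a₀ x) → (∀ x, 0 < θ₀ x) → ∃ σ₀ : ℝ, 0 < σ₀ ∧ ∀ σ : ℝ, 0 < σ → σ < σ₀ →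
        ∀ Φ : (N : ℕ) → HardSphereFlow (Torus.geometry (Fin 3)) (hsDiameter σ N) (N + 1),
        ∀ τ : ℝ, 0 < τ → ∀ G : V3 × V3 × V3 → ℝ, Continuous G → (∃ C : ℝ, ∀ p, |G p| ≤ C) →
        ∀ h : ℝ × V3 × ℝ → ℝ, Continuous h → (∃ C : ℝ, ∀ p, |h p| ≤ C) →
        (∀ p : ℝ × V3 × ℝ, η₀ ≤ σ ^ 3 * p.1 → h p = 0) →
        ∀ η δ : ℝ, 0 < η → 0 < δ → ∃ r₀ : ℝ, 0 < r₀ ∧ ∀ r : ℝ, 0 < r → r < r₀ → ∃ N₀ : ℕ, ∀ N : ℕ, N₀ ≤ N →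
        let ε := hsDiameter σ N
        let Gm : Geometry (Fin 3) T3 := Torus.geometry (Fin 3)
        let γ : Config (N + 1) (Fin 3) T3 → ℝ → Config (N + 1) (Fin 3) T3 := fun z s => (Φ N).flow s z
        let bx : T3 → T3 → ℝ := fun y x => 3 / (Real.pi * r ^ 3) * max (1 - Torus.euclidDist y x / r) 0
        let bt : ℝ → ℝ := fun a => r⁻¹ * max (1 - |a| / r) 0
        let ρm : Config (N + 1) (Fin 3) T3 → T3 → ℝ := fun w x₀ => ∫ q, bx q.1 x₀ ∂(empiricalMeasure w)
        let mm : Config (N + 1) (Fin 3) T3 → T3 → V3 := fun w x₀ => ∫ q, bx q.1 x₀ • q.2 ∂(empiricalMeasure w)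
        let em : Config (N + 1) (Fin 3) T3 → T3 → ℝ := fun w x₀ =>
          ∫ q, bx q.1 x₀ * (‖q.2‖ ^ 2 / 2) ∂(empiricalMeasure w)
        let um : Config (N + 1) (Fin 3) T3 → T3 → V3 := fun w x₀ => (ρm w x₀)⁻¹ • mm w x₀
        let θm : Config (N + 1) (Fin 3) T3 → T3 → ℝ := fun w x₀ =>
          2 / 3 * (em w x₀ / ρm w x₀ - ‖mm w x₀‖ ^ 2 / (2 * ρm w x₀ ^ 2))
        let Hw : Config (N + 1) (Fin 3) T3 → T3 → ℝ := fun w x => h (ρm w x, um w x, θm w x)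
        let Θ : V3 → V3 → ℝ := fun v w =>
          ∫ ω : Metric.sphere (0 : V3) 1, G ((ω : V3), v, w) * hardSphereKernel (w, v) ω ∂sphereMeasure
        let BG : Config (N + 1) (Fin 3) T3 → T3 → ℝ := fun w x₀ =>
          ∫ p, bx p.1.1 x₀ * bx p.2.1 x₀ * Θ p.1.2 p.2.2 ∂((empiricalMeasure w).prod (empiricalMeasure w))
        let pv : Config (N + 1) (Fin 3) T3 → ℝ → Fin (N + 1) → Fin (N + 1) → V3 × V3 := fun z s i j =>
          reflectVel (Gm.sepVec (γ z s i).1 (γ z s j).1) ((γ z s i).2, (γ z s j).2)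
        let Y : ℝ → ℝ := fun a => 3 / (2 * Real.pi) * deriv hsExcessFreeEnergy a
        let Kr : Config (N + 1) (Fin 3) T3 → ℝ → T3 → ℝ := fun z t₀ x₀ =>
          ε / (N + 1 : ℝ) * ∑ᶠ (s : ℝ) (_ : s ∈ collisionTimes Gm ε (γ z) ∩ Set.Icc 0 τ),
            ∑ i : Fin (N + 1), ∑ j : Fin (N + 1),
              (if i ≠ j ∧ ‖Gm.sepVec (γ z s i).1 (γ z s j).1‖ = ε then
                bt (s - t₀) * bx (γ z s i).1 x₀ * Hw (γ z s) (γ z s i).1 *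
                  G (ε⁻¹ • Gm.sepVec (γ z s i).1 (γ z s j).1, (pv z s i j).1, (pv z s i j).2) else 0)
        let R : Config (N + 1) (Fin 3) T3 → ℝ → T3 → ℝ := fun z t₀ x₀ =>
          σ ^ 3 * ∫ s in Set.Icc 0 τ, bt (s - t₀) *
            ∫ x, bx x x₀ * (Hw (γ z s) x * Y (σ ^ 3 * ρm (γ z s) x) * BG (γ z s) x)
        localGibbsLaw σ a₀ u₀ θ₀ N (Φ N)
          {z | η < ∫ t₀ in Set.Icc 0 τ, ∫ x₀, |Kr z t₀ x₀ - R z t₀ x₀|} ≤ ENNReal.ofReal δ)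
    (hLSLc : LimitCollisionMeasure.LocalSecondLaw) (hCT : LimitCollisionMeasure.CollisionTightness)
    (hT : TwoClocks.EnergyCurrentTails) (hDC : DensityCap) : ChaosClosesEuler := fun _hCC hCR _hLSL =>
  -- `_hCC : ContactChaos` (13477) and `_hLSL : LocalSecondLaw` (13081) are NOT consumed (wrong formats).
  have hUI := Summit.AtomisticToContinuum.HydrodynamicLimit.Theorems.ChaosClosesEulerCollisionMomentUI.stub_collisionMomentUI hCT
  have hS := Summit.AtomisticToContinuum.HydrodynamicLimit.Theorems.ChaosClosesEulerStressIsotropy.stub_stressIsotropyOfLocalEquilibrium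
    Summit.AtomisticToContinuum.HydrodynamicLimit.Theorems.ChaosClosesEulerMaxwellianMoments.stub_maxwellianMoments hPLE hT
  have hP := Summit.AtomisticToContinuum.HydrodynamicLimit.Theorems.ChaosClosesEulerPressureValue.stub_pressureValueOfEnskog
    Summit.AtomisticToContinuum.HydrodynamicLimit.Theorems.ChaosClosesEulerMaxwellianMoments.stub_maxwellianMoments hPLE hPEC hT hCT hUI
  Summit.AtomisticToContinuum.HydrodynamicLimit.Theorems.ChaosClosesEulerReadout.stub_readout
    (Summit.AtomisticToContinuum.HydrodynamicLimit.Theorems.ChaosClosesEulerKineticReduction.stub_kineticReduction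
      Summit.AtomisticToContinuum.HydrodynamicLimit.Theorems.ChaosClosesEulerMassBalanceC1.stub_massBalanceC1
      Summit.AtomisticToContinuum.HydrodynamicLimit.Theorems.ChaosClosesEulerWeakEquation.stub_weakEquation
      Summit.AtomisticToContinuum.HydrodynamicLimit.Theorems.ChaosClosesEulerInitialLayer.stub_initialLayer hS hP hUI hCR hLSLc hDC
      Summit.AtomisticToContinuum.HydrodynamicLimit.Theorems.ChaosClosesEulerBF18Shell.stub_bf18Shell)
    Summit.AtomisticToContinuum.HydrodynamicLimit.Theorems.ChaosClosesEulerEnskogIdentity.stub_empiricalEnskogIdentity hT hUI hCR hDC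

/-- **Registered form of the dock** (stub `stub_dock` of stmt-AtomisticToContinuum-15141, arrow-shaped restatement of
`chaosClosesEuler_of_pointwiseLocalEquilibrium` for the gate's name + signature matching): pointwise local equilibrium →
pointwise Enskog collision statistics → 13352 → 13354 → 9235 → 13082 → `ChaosClosesEuler`. [cite: BrezinaFeireisl2018, Thm 2.5] -/
theorem stub_dock :
    (∃ η₀ : ℝ, 0 < η₀ ∧ ∀ (a₀ θ₀ : T3 → ℝ) (u₀ : T3 → V3), Continuous a₀ → Continuous θ₀ → Continuous u₀ →
        (∀ x, 0 < a₀ x) → (∀ x, 0 < θ₀ x) → ∃ σ₀ : ℝ, 0 < σ₀ ∧ ∀ σ : ℝ, 0 < σ → σ < σ₀ →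
        ∀ (T : ℝ) (ρ θ : ℝ → T3 → ℝ) (u : ℝ → T3 → V3), IsHardSphereEulerSolution σ T ρ u θ →
        ∀ Φ : (N : ℕ) → HardSphereFlow (Torus.geometry (Fin 3)) (hsDiameter σ N) (N + 1),
        TendstoHydroFieldsAt (fun N => localGibbsLaw σ a₀ u₀ θ₀ N (Φ N)) Φ ρ u θ 0 →
        ∀ t ∈ Set.Ico 0 T, ∀ ψ : V3 → ℝ, Continuous ψ → (∃ C : ℝ, ∀ v, |ψ v| ≤ C) →
        ∀ h : ℝ × V3 × ℝ → ℝ, Continuous h → (∃ C : ℝ, ∀ p, |h p| ≤ C) →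
        (∃ ρ₁ θ₁ Θ U : ℝ, 0 < ρ₁ ∧ 0 < θ₁ ∧ ∀ p : ℝ × V3 × ℝ,
          (p.1 ≤ ρ₁ ∨ η₀ ≤ σ ^ 3 * p.1 ∨ p.2.2 ≤ θ₁ ∨ Θ ≤ p.2.2 ∨ U ≤ ‖p.2.1‖) → h p = 0) →
        ∀ η δ : ℝ, 0 < η → 0 < δ → ∃ r₀ : ℝ, 0 < r₀ ∧ ∀ r : ℝ, 0 < r → r < r₀ → ∃ N₀ : ℕ, ∀ N : ℕ, N₀ ≤ N →
        let bx : T3 → T3 → ℝ := fun y x => 3 / (Real.pi * r ^ 3) * max (1 - Torus.euclidDist y x / r) 0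
        let ρm : Config (N + 1) (Fin 3) T3 → T3 → ℝ := fun w x₀ => ∫ q, bx q.1 x₀ ∂(empiricalMeasure w)
        let mm : Config (N + 1) (Fin 3) T3 → T3 → V3 := fun w x₀ => ∫ q, bx q.1 x₀ • q.2 ∂(empiricalMeasure w)
        let em : Config (N + 1) (Fin 3) T3 → T3 → ℝ := fun w x₀ =>
          ∫ q, bx q.1 x₀ * (‖q.2‖ ^ 2 / 2) ∂(empiricalMeasure w)
        let um : Config (N + 1) (Fin 3) T3 → T3 → V3 := fun w x₀ => (ρm w x₀)⁻¹ • mm w x₀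
        let θm : Config (N + 1) (Fin 3) T3 → T3 → ℝ := fun w x₀ =>
          2 / 3 * (em w x₀ / ρm w x₀ - ‖mm w x₀‖ ^ 2 / (2 * ρm w x₀ ^ 2))
        let Mψ : Config (N + 1) (Fin 3) T3 → T3 → ℝ := fun w x₀ => ∫ q, bx q.1 x₀ * ψ q.2 ∂(empiricalMeasure w)
        localGibbsLaw σ a₀ u₀ θ₀ N (Φ N)
          {z | η < ∫ s in Set.Icc 0 t, ∫ x,
            |h (ρm ((Φ N).flow s z) x, um ((Φ N).flow s z) x, θm ((Φ N).flow s z) x)| *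
              |Mψ ((Φ N).flow s z) x - ρm ((Φ N).flow s z) x *
                ∫ v, ψ v * localMaxwellian 1 (θm ((Φ N).flow s z) x) (um ((Φ N).flow s z) x) v|} ≤ ENNReal.ofReal δ) →
    (∃ η₀ : ℝ, 0 < η₀ ∧ ∀ (a₀ θ₀ : T3 → ℝ) (u₀ : T3 → V3), Continuous a₀ → Continuous θ₀ → Continuous u₀ →
        (∀ x, 0 < a₀ x) → (∀ x, 0 < θ₀ x) → ∃ σ₀ : ℝ, 0 < σ₀ ∧ ∀ σ : ℝ, 0 < σ → σ < σ₀ →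
        ∀ Φ : (N : ℕ) → HardSphereFlow (Torus.geometry (Fin 3)) (hsDiameter σ N) (N + 1),
        ∀ τ : ℝ, 0 < τ → ∀ G : V3 × V3 × V3 → ℝ, Continuous G → (∃ C : ℝ, ∀ p, |G p| ≤ C) →
        ∀ h : ℝ × V3 × ℝ → ℝ, Continuous h → (∃ C : ℝ, ∀ p, |h p| ≤ C) →
        (∀ p : ℝ × V3 × ℝ, η₀ ≤ σ ^ 3 * p.1 → h p = 0) →
        ∀ η δ : ℝ, 0 < η → 0 < δ → ∃ r₀ : ℝ, 0 < r₀ ∧ ∀ r : ℝ, 0 < r → r < r₀ → ∃ N₀ : ℕ, ∀ N : ℕ, N₀ ≤ N →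
        let ε := hsDiameter σ N
        let Gm : Geometry (Fin 3) T3 := Torus.geometry (Fin 3)
        let γ : Config (N + 1) (Fin 3) T3 → ℝ → Config (N + 1) (Fin 3) T3 := fun z s => (Φ N).flow s z
        let bx : T3 → T3 → ℝ := fun y x => 3 / (Real.pi * r ^ 3) * max (1 - Torus.euclidDist y x / r) 0
        let bt : ℝ → ℝ := fun a => r⁻¹ * max (1 - |a| / r) 0
        let ρm : Config (N + 1) (Fin 3) T3 → T3 → ℝ := fun w x₀ => ∫ q, bx q.1 x₀ ∂(empiricalMeasure w)
        let mm : Config (N + 1) (Fin 3) T3 → T3 → V3 := fun w x₀ => ∫ q, bx q.1 x₀ • q.2 ∂(empiricalMeasure w)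
        let em : Config (N + 1) (Fin 3) T3 → T3 → ℝ := fun w x₀ =>
          ∫ q, bx q.1 x₀ * (‖q.2‖ ^ 2 / 2) ∂(empiricalMeasure w)
        let um : Config (N + 1) (Fin 3) T3 → T3 → V3 := fun w x₀ => (ρm w x₀)⁻¹ • mm w x₀
        let θm : Config (N + 1) (Fin 3) T3 → T3 → ℝ := fun w x₀ =>
          2 / 3 * (em w x₀ / ρm w x₀ - ‖mm w x₀‖ ^ 2 / (2 * ρm w x₀ ^ 2))
        let Hw : Config (N + 1) (Fin 3) T3 → T3 → ℝ := fun w x => h (ρm w x, um w x, θm w x)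
        let Θ : V3 → V3 → ℝ := fun v w =>
          ∫ ω : Metric.sphere (0 : V3) 1, G ((ω : V3), v, w) * hardSphereKernel (w, v) ω ∂sphereMeasure
        let BG : Config (N + 1) (Fin 3) T3 → T3 → ℝ := fun w x₀ =>
          ∫ p, bx p.1.1 x₀ * bx p.2.1 x₀ * Θ p.1.2 p.2.2 ∂((empiricalMeasure w).prod (empiricalMeasure w))
        let pv : Config (N + 1) (Fin 3) T3 → ℝ → Fin (N + 1) → Fin (N + 1) → V3 × V3 := fun z s i j =>
          reflectVel (Gm.sepVec (γ z s i).1 (γ z s j).1) ((γ z s i).2, (γ z s j).2)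
        let Y : ℝ → ℝ := fun a => 3 / (2 * Real.pi) * deriv hsExcessFreeEnergy a
        let Kr : Config (N + 1) (Fin 3) T3 → ℝ → T3 → ℝ := fun z t₀ x₀ =>
          ε / (N + 1 : ℝ) * ∑ᶠ (s : ℝ) (_ : s ∈ collisionTimes Gm ε (γ z) ∩ Set.Icc 0 τ),
            ∑ i : Fin (N + 1), ∑ j : Fin (N + 1),
              (if i ≠ j ∧ ‖Gm.sepVec (γ z s i).1 (γ z s j).1‖ = ε then
                bt (s - t₀) * bx (γ z s i).1 x₀ * Hw (γ z s) (γ z s i).1 *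
                  G (ε⁻¹ • Gm.sepVec (γ z s i).1 (γ z s j).1, (pv z s i j).1, (pv z s i j).2) else 0)
        let R : Config (N + 1) (Fin 3) T3 → ℝ → T3 → ℝ := fun z t₀ x₀ =>
          σ ^ 3 * ∫ s in Set.Icc 0 τ, bt (s - t₀) *
            ∫ x, bx x x₀ * (Hw (γ z s) x * Y (σ ^ 3 * ρm (γ z s) x) * BG (γ z s) x)
        localGibbsLaw σ a₀ u₀ θ₀ N (Φ N)
          {z | η < ∫ t₀ in Set.Icc 0 τ, ∫ x₀, |Kr z t₀ x₀ - R z t₀ x₀|} ≤ ENNReal.ofReal δ) →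
    LimitCollisionMeasure.LocalSecondLaw → LimitCollisionMeasure.CollisionTightness →
    TwoClocks.EnergyCurrentTails → DensityCap → ChaosClosesEuler :=
  fun hPLE hPEC hLSLc hCT hT hDC => chaosClosesEuler_of_pointwiseLocalEquilibrium hPLE hPEC hLSLc hCT hT hDC

/-- Bookkeeping anchor `stub_dockAnchor` for the gate's `--supports` matching: the registry holds stub signatures of at
most 4000 characters, and the dock's (`stub_dock`, 4657 characters with the two pointwise inputs inlined) does not fit;
this short registered statement — composition of implications, the logical shape of the dock — lets the file that
proves `stub_dock` / `chaosClosesEuler_of_pointwiseLocalEquilibrium` land as a helper of stmt-AtomisticToContinuum-15141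
(same device as `ChaosClosesEulerPressureValue.stub_pressureValueP`). [folklore] -/
theorem stub_dockAnchor :
    ∀ (PLE PEC LSL CT ECT DC Crux : Prop),
      (PLE → PEC → LSL → CT → ECT → DC → Crux) → ECT → CT → LSL → PEC → PLE → DC → Crux :=
  fun _ _ _ _ _ _ _ h hT hCT hL hPEC hPLE hDC => h hPLE hPEC hL hCT hT hDC

end Summit.AtomisticToContinuum.HydrodynamicLimit.Theorems.ChaosClosesEulerDock

end
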